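import Summits.AtomisticToContinuum.FouriersLaw.Theorems.HonestZwanzigNetworkReductionPackage
import Summits.AtomisticToContinuum.FouriersLaw.Theorems.HonestZwanzigGeneratorSiteEnergy
import Summits.AtomisticToContinuum.FouriersLaw.Theorems.HonestZwanzigParityStatics

/-!
# HonestZwanzig / OrthogonalOhm — the fixed-`N` regression identity (stub R1 of line `Sketch`)

Support file for the crux item `stmt-AtomisticToContinuum-12693` (`OrthogonalOhm` of route
`HonestZwanzig`, sub-problem `FouriersLaw`), card `regression-ward-identity`, stub
`stub_regressionIdentity` (R1). At fixed `N ≥ 2`, every Laplace variable `s > 0`, every bond `b` and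
every real origin `a`:

  `schur_s(j_b, J) = reg_s(b; a) − a·γ·schur_s(j_b, p_0²) + (N − 1 − a)·γ·schur_s(j_b, p²_{N−1})`,
  `reg_s(b; a) = Σ_{x,y,z} lap_s(j_b, e_x) (G(s)⁻¹)_{xy} cov(e_y, e_z) (z − a)`.

Proof (Feshbach-block algebra over the canonical objects of the route):
* the open-chain coboundary, pointwise: `J = Σ_x (x − a)·L e_x − aγ p_0² + (N−1−a)γ p²_{N−1} + const`
  (`GeneratorSiteEnergy` summed against `x − a`, `j_{N−1} ≡ 0`) — `totalCurrent_pointwise`;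
* linearity of `g ↦ lap_s(f, g)` on admissible observables (time reversal `lap_rev` + the first-slot
  linearity of the `NetworkReduction` infrastructure; constants pair to `0`) — `lapR_lincomb`, and of
  `g ↦ schur_s(f, g)` — `schur_lincomb_right`;
* the second Kolmogorov identity `lap_s(f, L e_x) = s·lap_s(f, e_x) − cov(f, e_x)` for `f = j_b` and
  `f = e_v`, parity `cov(j_b, e_x) = 0` (`ParityStatics`, `∫ j_b dμ = 0`) and `G(s)⁻¹ G(s) = 1`
  (`G(s)` symmetric positive definite): `schur_s(j_b, L e_x) = Σ_{u,v} lap_s(j_b,e_u) G⁻¹_{uv} cov(e_v,e_x)`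
  — `schur_j_generator`.
-/

noncomputable section

open MeasureTheory Finset Real Set Filter ProbabilityTheory
open Literature.MathematicalPhysics.KineticTheory.HeatConduction

namespace Summit.AtomisticToContinuum.FouriersLaw.Theorems.HonestZwanzig

namespace OrthogonalOhmLine.RegressionIdentity

open NetworkReduction

/-! ### Second-slot linearity of the Schur pairing (abstract pairings at one fixed `s`) -/

/-- Linearity of `g ↦ schur(f, g)` along a finite linear relation (a `Fin N`-family plus two extra
observables) valid against `f` and against every `e u` in the first slot. -/
theorem schur_lincomb_right {X : Type*} {N : ℕ} (lap schur : (X → ℝ) → (X → ℝ) → ℝ)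
    (e : Fin N → X → ℝ) (G : Matrix (Fin N) (Fin N) ℝ)
    (hschur : ∀ f g, schur f g = lap f g - ∑ x, ∑ y, lap f (e x) * G⁻¹ x y * lap (e y) g)
    (w : Fin N → ℝ) (w₀ w₁ : ℝ) (f g g₀ g₁ : X → ℝ) (gs : Fin N → X → ℝ)
    (hf : lap f g = (∑ v, w v * lap f (gs v)) + w₀ * lap f g₀ + w₁ * lap f g₁)
    (he : ∀ u, lap (e u) g = (∑ v, w v * lap (e u) (gs v)) + w₀ * lap (e u) g₀ + w₁ * lap (e u) g₁) :
    schur f g = (∑ v, w v * schur f (gs v)) + w₀ * schur f g₀ + w₁ * schur f g₁ := by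
  simp only [hschur]
  rw [hf]
  simp_rw [he]
  have h1 : ∀ x y, lap f (e x) * G⁻¹ x y *
      ((∑ v, w v * lap (e y) (gs v)) + w₀ * lap (e y) g₀ + w₁ * lap (e y) g₁) =
      (∑ v, w v * (lap f (e x) * G⁻¹ x y * lap (e y) (gs v))) +
        w₀ * (lap f (e x) * G⁻¹ x y * lap (e y) g₀) + w₁ * (lap f (e x) * G⁻¹ x y * lap (e y) g₁) := by
    intro x y
    rw [mul_add, mul_add, Finset.mul_sum]
    refine congrArg₂ _ (congrArg₂ _ (Finset.sum_congr rfl fun v _ => ?_) ?_) ?_ <;> ring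
  simp_rw [h1]
  simp only [Finset.sum_add_distrib, ← Finset.mul_sum]
  have h2 : ∑ x, ∑ y, ∑ v, w v * (lap f (e x) * G⁻¹ x y * lap (e y) (gs v)) =
      ∑ v, w v * ∑ x, ∑ y, lap f (e x) * G⁻¹ x y * lap (e y) (gs v) := by
    symm
    simp only [Finset.mul_sum]
    rw [Finset.sum_comm]
    refine Finset.sum_congr rfl fun x _ => ?_
    rw [Finset.sum_comm]
  rw [h2]
  simp only [mul_sub, Finset.sum_sub_distrib]
  ring

/-! ### The canonical objects at fixed `N`: second-slot linearity, parity, the coboundary -/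

section Canonical

variable {ω₂ lam β γ : ℝ} {N : ℕ} {T : ℝ}
  {Adm : (PhaseSpace N → ℝ) → Prop}
  {corr : (PhaseSpace N → ℝ) → (PhaseSpace N → ℝ) → ℝ → ℝ}
  {lap : ℝ → (PhaseSpace N → ℝ) → (PhaseSpace N → ℝ) → ℝ}
  {cov : (PhaseSpace N → ℝ) → (PhaseSpace N → ℝ) → ℝ}
  {e : Fin N → PhaseSpace N → ℝ}
  (hAdm : ∀ f, Adm f ↔ (Continuous f ∧ ∃ A : ℝ, ∀ z,
    |f z| ≤ A * Real.exp ((pinnedChain ω₂ lam β γ).hamiltonian N z / (8 * T))))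
  (hcorr : ∀ f g t, corr f g t =
    (∫ z, f z * (∫ y, g y ∂((pinnedChain ω₂ lam β γ).transitionKernel N T T t.toNNReal z))
      ∂(pinnedChain ω₂ lam β γ).gibbsMeasure N T) -
    (∫ z, f z ∂(pinnedChain ω₂ lam β γ).gibbsMeasure N T) *
      (∫ z, g z ∂(pinnedChain ω₂ lam β γ).gibbsMeasure N T))
  (hlap : ∀ s f g, lap s f g = ∫ t in Set.Ioi (0 : ℝ), Real.exp (-(s * t)) * corr f g t)
  (hcov : ∀ f g, cov f g = (∫ z, f z * g z ∂(pinnedChain ω₂ lam β γ).gibbsMeasure N T) -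
    (∫ z, f z ∂(pinnedChain ω₂ lam β γ).gibbsMeasure N T) *
      (∫ z, g z ∂(pinnedChain ω₂ lam β γ).gibbsMeasure N T))
  (he : ∀ x z, e x z = z.2 x ^ 2 / 2 + (pinnedChain ω₂ lam β γ).U (z.1 x) +
    ∑ j : Fin N, ((if j.val = x.val + 1 then (pinnedChain ω₂ lam β γ).V (z.1 j - z.1 x) / 2 else 0) +
      (if x.val = j.val + 1 then (pinnedChain ω₂ lam β γ).V (z.1 x - z.1 j) / 2 else 0)))
  (hFI : ∀ f g : PhaseSpace N → ℝ, Adm f → Adm g →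
    Integrable f ((pinnedChain ω₂ lam β γ).gibbsMeasure N T) ∧
    (∀ t : ℝ, 0 ≤ t → Integrable (fun z => f z *
      (∫ y, g y ∂((pinnedChain ω₂ lam β γ).transitionKernel N T T t.toNNReal z)))
      ((pinnedChain ω₂ lam β γ).gibbsMeasure N T)) ∧
    IntegrableOn (corr f g) (Set.Ioi 0) ∧
    (∀ t : ℝ, 0 ≤ t → corr f g t = corr (fun z => g (z.1, -z.2)) (fun z => f (z.1, -z.2)) t) ∧
    (∀ s : ℝ, 0 < s → ∀ x : Fin N,
      s * lap s (e x) g - cov (e x) g =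
        lap s (fun z => (pinnedChain ω₂ lam β γ).generator N T T (e x) (z.1, -z.2)) g ∧
      s * lap s f (e x) - cov f (e x) = lap s f ((pinnedChain ω₂ lam β γ).generator N T T (e x))))
  (hGSE : ∀ (x : Fin N) (z : PhaseSpace N), (pinnedChain ω₂ lam β γ).generator N T T (e x) z =
    (∑ b : Fin N, ((if x.val = b.val + 1 then (pinnedChain ω₂ lam β γ).bondCurrent N b z else 0) -
      (if b = x then (pinnedChain ω₂ lam β γ).bondCurrent N b z else 0))) +
    (if x.val = 0 then (pinnedChain ω₂ lam β γ).γ * (T - z.2 x ^ 2) else 0) +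
    (if x.val = N - 1 then (pinnedChain ω₂ lam β γ).γ * (T - z.2 x ^ 2) else 0))
  (hPS1 : ∀ x b : Fin N, ∫ z, e x z * (pinnedChain ω₂ lam β γ).bondCurrent N b z
    ∂(pinnedChain ω₂ lam β γ).gibbsMeasure N T = 0)
  (hω : 0 < ω₂) (hl : 0 ≤ lam) (hβ : 0 ≤ β) (hγ : 0 ≤ γ) (hT : 0 < T)

include hcorr hlap hω hl hβ hγ hT in
/-- `lap_s(f, c) = 0`: constants in the second slot pair to zero (Markov kernels, probability Gibbs
state). -/
theorem lapR_const (s : ℝ) (f : PhaseSpace N → ℝ) (c : ℝ) : lap s f (fun _ => c) = 0 := by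
  rw [hlap]
  simp only [corr_const_right hcorr hω hl hβ hγ hT, mul_zero, integral_zero]

include hAdm hcorr hlap hFI in
/-- Additivity of `g ↦ lap_s(f, g)` on admissible observables, `s ≥ 0` (time reversal and
first-slot additivity). -/
theorem lapR_add {f g₁ g₂ : PhaseSpace N → ℝ} (hf : Adm f) (h₁ : Adm g₁) (h₂ : Adm g₂)
    {s : ℝ} (hs : 0 ≤ s) : lap s f (fun z => g₁ z + g₂ z) = lap s f g₁ + lap s f g₂ := by
  rw [lap_rev hlap hFI hf (adm_add Adm hAdm h₁ h₂) s, lap_rev hlap hFI hf h₁ s,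
    lap_rev hlap hFI hf h₂ s]
  exact lap_add_left hcorr hlap hFI (adm_rev Adm hAdm h₁) (adm_rev Adm hAdm h₂)
    (adm_rev Adm hAdm hf) hs

include hAdm hcorr hlap hFI hω hl hβ hT in
/-- Weighted finite sums in the second slot of `lap_s`, `s ≥ 0`. -/
theorem lapR_sum (w : Fin N → ℝ) (gs : Fin N → PhaseSpace N → ℝ) (hgs : ∀ i, Adm (gs i))
    {f : PhaseSpace N → ℝ} (hf : Adm f) {s : ℝ} (hs : 0 ≤ s) :
    lap s f (fun z => ∑ i, w i * gs i z) = ∑ i, w i * lap s f (gs i) := by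
  have hS : Adm (fun z => ∑ i, w i * gs i z) :=
    adm_sum Adm hAdm Finset.univ (fun i z => w i * gs i z) (adm_const Adm hAdm hω hl hβ hT 0)
      fun i _ => adm_const_mul Adm hAdm (w i) (hgs i)
  rw [lap_rev hlap hFI hf hS s]
  have h := lap_sum_left hAdm hcorr hlap hFI hω hl hβ hT Finset.univ w
    (fun i z => gs i (z.1, -z.2)) (fun i _ => adm_rev Adm hAdm (hgs i)) (adm_rev Adm hAdm hf) hs
  refine h.trans (Finset.sum_congr rfl fun i _ => ?_)
  exact congrArg (w i * ·) (lap_rev hlap hFI hf (hgs i) s).symm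

include hAdm hcorr hlap hFI hω hl hβ hγ hT in
/-- A finite linear combination plus a constant in the SECOND slot of `lap_s`: if
`g = Σ_x w_x g_x + w₀ g₀ + w₁ g₁ + c₀` pointwise (all admissible) then
`lap_s(f, g) = Σ_x w_x lap_s(f, g_x) + w₀ lap_s(f, g₀) + w₁ lap_s(f, g₁)` for admissible `f`, `s ≥ 0`. -/
theorem lapR_lincomb (w : Fin N → ℝ) (w₀ w₁ c₀ : ℝ) (gs : Fin N → PhaseSpace N → ℝ)
    (g₀ g₁ g : PhaseSpace N → ℝ) (hg : ∀ z, g z = (∑ x, w x * gs x z) + w₀ * g₀ z + w₁ * g₁ z + c₀)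
    (hgs : ∀ x, Adm (gs x)) (hg₀ : Adm g₀) (hg₁ : Adm g₁) {f : PhaseSpace N → ℝ} (hf : Adm f)
    {s : ℝ} (hs : 0 ≤ s) :
    lap s f g = (∑ x, w x * lap s f (gs x)) + w₀ * lap s f g₀ + w₁ * lap s f g₁ := by
  have hA : Adm (fun z => ∑ x, w x * gs x z) :=
    adm_sum Adm hAdm Finset.univ (fun x z => w x * gs x z) (adm_const Adm hAdm hω hl hβ hT 0)
      fun x _ => adm_const_mul Adm hAdm (w x) (hgs x)
  have hB : Adm (fun z => w₀ * g₀ z) := adm_const_mul Adm hAdm w₀ hg₀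
  have hC : Adm (fun z => w₁ * g₁ z) := adm_const_mul Adm hAdm w₁ hg₁
  have hAB : Adm (fun z => (∑ x, w x * gs x z) + w₀ * g₀ z) := adm_add Adm hAdm hA hB
  have hABC : Adm (fun z => (∑ x, w x * gs x z) + w₀ * g₀ z + w₁ * g₁ z) := adm_add Adm hAdm hAB hC
  have hK : Adm (fun _ : PhaseSpace N => c₀) := adm_const Adm hAdm hω hl hβ hT c₀
  have hgeq : g = fun z => ((∑ x, w x * gs x z) + w₀ * g₀ z + w₁ * g₁ z) + c₀ := funext hg
  have h1 := lapR_add hAdm hcorr hlap hFI hf hABC hK hs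
  have h2 := lapR_add hAdm hcorr hlap hFI hf hAB hC hs
  have h3 := lapR_add hAdm hcorr hlap hFI hf hA hB hs
  rw [hgeq, h1, h2, h3, lapR_const hcorr hlap hω hl hβ hγ hT, add_zero,
    lap_const_mul_right hcorr hlap, lap_const_mul_right hcorr hlap,
    lapR_sum hAdm hcorr hlap hFI hω hl hβ hT w gs hgs hf hs]

include hcov hPS1 in
/-- Parity: `cov(j_b, e_x) = 0` (`∫ j_b dμ = 0` and `∫ e_x j_b dμ = 0`, first clause of
`ParityStatics`). -/
theorem cov_j_e (b x : Fin N) : cov ((pinnedChain ω₂ lam β γ).bondCurrent N b) (e x) = 0 := by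
  rw [hcov, pinnedChain_integral_bondCurrent_gibbsMeasure, zero_mul, sub_zero]
  simp_rw [mul_comm ((pinnedChain ω₂ lam β γ).bondCurrent N b _) (e x _)]
  exact hPS1 x b

include hGSE in
/-- The open-chain coboundary, pointwise: for every real origin `a`,
`J = Σ_x (x − a)·L e_x − aγ·p_0² + (N−1−a)γ·p²_{N−1} + (aγT − (N−1−a)γT)`
(`GeneratorSiteEnergy` summed against `x − a`: `Σ_x (x − a)(j_{x−1} − j_x) = J` since `j_{N−1} ≡ 0`). -/
theorem totalCurrent_pointwise (hN : 2 ≤ N) (a : ℝ) (z : PhaseSpace N) :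
    (∑ i : Fin N, (pinnedChain ω₂ lam β γ).bondCurrent N i z) =
      (∑ x : Fin N, ((x.val : ℝ) - a) * (pinnedChain ω₂ lam β γ).generator N T T (e x) z) +
      (-(a * (pinnedChain ω₂ lam β γ).γ)) * z.2 (⟨0, by omega⟩ : Fin N) ^ 2 +
      ((((N : ℝ) - 1) - a) * (pinnedChain ω₂ lam β γ).γ) * z.2 (⟨N - 1, by omega⟩ : Fin N) ^ 2 +
      (a * (pinnedChain ω₂ lam β γ).γ * T - (((N : ℝ) - 1) - a) * (pinnedChain ω₂ lam β γ).γ * T) := by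
  -- the divergence part: `Σ_x (x − a)(j_{x−1} − j_x) = J`
  have hD : (∑ x : Fin N, ((x.val : ℝ) - a) *
      ∑ b : Fin N, ((if x.val = b.val + 1 then (pinnedChain ω₂ lam β γ).bondCurrent N b z else 0) -
        (if b = x then (pinnedChain ω₂ lam β γ).bondCurrent N b z else 0))) =
      ∑ i : Fin N, (pinnedChain ω₂ lam β γ).bondCurrent N i z := by
    simp only [Finset.mul_sum, mul_sub, mul_ite, mul_zero]
    rw [Finset.sum_comm]
    refine Finset.sum_congr rfl fun b _ => ?_
    rw [Finset.sum_sub_distrib, Finset.sum_ite_eq]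
    simp only [Finset.mem_univ, if_true]
    by_cases hb : b.val + 1 < N
    · rw [sum_ite_succ_eq _ b hb]
      simp only [Nat.cast_add, Nat.cast_one]
      ring
    · rw [sum_ite_succ_eq_zero _ b hb, bondCurrent_eq_zero_of_last _ b hb]
      ring
  -- the two bath terms
  have hB0 : (∑ x : Fin N, ((x.val : ℝ) - a) *
      (if x.val = 0 then (pinnedChain ω₂ lam β γ).γ * (T - z.2 x ^ 2) else 0)) =
      (0 - a) * ((pinnedChain ω₂ lam β γ).γ * (T - z.2 (⟨0, by omega⟩ : Fin N) ^ 2)) := by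
    simp only [mul_ite, mul_zero]
    rw [sum_ite_val_eq 0 (by omega)]
    simp only [Nat.cast_zero]
  have hN1 : ((N - 1 : ℕ) : ℝ) = (N : ℝ) - 1 := by
    rw [Nat.cast_sub (by omega), Nat.cast_one]
  have hB1 : (∑ x : Fin N, ((x.val : ℝ) - a) *
      (if x.val = N - 1 then (pinnedChain ω₂ lam β γ).γ * (T - z.2 x ^ 2) else 0)) =
      (((N : ℝ) - 1) - a) * ((pinnedChain ω₂ lam β γ).γ * (T - z.2 (⟨N - 1, by omega⟩ : Fin N) ^ 2)) := by
    simp only [mul_ite, mul_zero]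
    rw [sum_ite_val_eq (N - 1) (by omega), hN1]
  have key : ∀ x : Fin N, ((x.val : ℝ) - a) * (pinnedChain ω₂ lam β γ).generator N T T (e x) z =
      ((x.val : ℝ) - a) *
        (∑ b : Fin N, ((if x.val = b.val + 1 then (pinnedChain ω₂ lam β γ).bondCurrent N b z else 0) -
          (if b = x then (pinnedChain ω₂ lam β γ).bondCurrent N b z else 0))) +
      ((x.val : ℝ) - a) * (if x.val = 0 then (pinnedChain ω₂ lam β γ).γ * (T - z.2 x ^ 2) else 0) +
      ((x.val : ℝ) - a) * (if x.val = N - 1 then (pinnedChain ω₂ lam β γ).γ * (T - z.2 x ^ 2) else 0) := by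
    intro x
    rw [hGSE]
    ring
  simp only [key, Finset.sum_add_distrib]
  rw [hD, hB0, hB1]
  ring

include hAdm hcov he hFI hPS1 hω hl hβ hT in
/-- The clamped response of `j_b` to `L e_x`: by the second Kolmogorov identity, parity
`cov(j_b, e_x) = 0` and `G(s)⁻¹ G(s) = 1`,
`schur_s(j_b, L e_x) = Σ_{u,v} lap_s(j_b, e_u) (G(s)⁻¹)_{uv} cov(e_v, e_x)`. -/
theorem schur_j_generator {s : ℝ} (hs : 0 < s)
    (G : Matrix (Fin N) (Fin N) ℝ) (hG : ∀ x y, G x y = lap s (e x) (e y))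
    (schur : (PhaseSpace N → ℝ) → (PhaseSpace N → ℝ) → ℝ)
    (hschur : ∀ f g, schur f g = lap s f g - ∑ x, ∑ y, lap s f (e x) * G⁻¹ x y * lap s (e y) g)
    (hGG : G⁻¹ * G = 1) (b x : Fin N) :
    schur ((pinnedChain ω₂ lam β γ).bondCurrent N b) ((pinnedChain ω₂ lam β γ).generator N T T (e x)) =
      ∑ u, ∑ v, lap s ((pinnedChain ω₂ lam β γ).bondCurrent N b) (e u) * G⁻¹ u v * cov (e v) (e x) := by
  have hjb : Adm ((pinnedChain ω₂ lam β γ).bondCurrent N b) := adm_bondCurrent Adm hAdm hω hl hβ hT b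
  have hex : ∀ u, Adm (e u) := fun u => adm_e Adm hAdm e he hω hl hβ hT u
  have k : lap s ((pinnedChain ω₂ lam β γ).bondCurrent N b)
      ((pinnedChain ω₂ lam β γ).generator N T T (e x)) =
      s * lap s ((pinnedChain ω₂ lam β γ).bondCurrent N b) (e x) := by
    rw [← ((hFI _ _ hjb (hex x)).2.2.2.2 s hs x).2, cov_j_e hcov hPS1 b x, sub_zero]
  have k2 : ∀ u v, lap s ((pinnedChain ω₂ lam β γ).bondCurrent N b) (e u) * G⁻¹ u v *
      lap s (e v) ((pinnedChain ω₂ lam β γ).generator N T T (e x)) =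
      s * (lap s ((pinnedChain ω₂ lam β γ).bondCurrent N b) (e u) * (G⁻¹ u v * G v x)) -
        lap s ((pinnedChain ω₂ lam β γ).bondCurrent N b) (e u) * G⁻¹ u v * cov (e v) (e x) := by
    intro u v
    rw [pkg_K2 hAdm he hFI hω hl hβ hT hs v x, ← hG]
    ring
  have k3 : ∀ u, ∑ v, G⁻¹ u v * G v x = if u = x then 1 else 0 := by
    intro u
    have h := congrFun (congrFun hGG u) x
    rw [Matrix.mul_apply, Matrix.one_apply] at h
    exact h
  rw [hschur, k]
  simp only [k2, Finset.sum_sub_distrib, ← Finset.mul_sum, k3, mul_ite, mul_one, mul_zero,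
    Finset.sum_ite_eq', Finset.mem_univ, if_true]
  ring

include hAdm hcorr hlap hcov he hFI hGSE hPS1 hω hl hβ hγ hT in
/-- **The regression identity at fixed `N` and fixed `s > 0`** (abstract form over the canonical
objects): for every bond `b` and every real origin `a`,
`schur_s(j_b, J) = Σ_{x,y,z} lap_s(j_b,e_x) (G(s)⁻¹)_{xy} cov(e_y,e_z) (z − a) − aγ·schur_s(j_b, p_0²)
  + (N−1−a)γ·schur_s(j_b, p²_{N−1})`. -/
theorem regressionIdentity_fixed (hN : 2 ≤ N) {s : ℝ} (hs : 0 < s)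
    (G : Matrix (Fin N) (Fin N) ℝ) (hG : ∀ x y, G x y = lap s (e x) (e y))
    (schur : (PhaseSpace N → ℝ) → (PhaseSpace N → ℝ) → ℝ)
    (hschur : ∀ f g, schur f g = lap s f g - ∑ x, ∑ y, lap s f (e x) * G⁻¹ x y * lap s (e y) g)
    (hGp : ∀ v : Fin N → ℝ, v ≠ 0 → 0 < ∑ x, ∑ y, v x * G x y * v y) (b : Fin N) (a : ℝ) :
    schur ((pinnedChain ω₂ lam β γ).bondCurrent N b)
        (fun z => ∑ i : Fin N, (pinnedChain ω₂ lam β γ).bondCurrent N i z) =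
      (∑ x, ∑ y, ∑ z : Fin N, lap s ((pinnedChain ω₂ lam β γ).bondCurrent N b) (e x) * G⁻¹ x y *
          cov (e y) (e z) * ((z.val : ℝ) - a)) -
        a * (pinnedChain ω₂ lam β γ).γ *
          schur ((pinnedChain ω₂ lam β γ).bondCurrent N b) (fun w => w.2 (⟨0, by omega⟩ : Fin N) ^ 2) +
      (((N : ℝ) - 1) - a) * (pinnedChain ω₂ lam β γ).γ *
          schur ((pinnedChain ω₂ lam β γ).bondCurrent N b)
            (fun w => w.2 (⟨N - 1, by omega⟩ : Fin N) ^ 2) := by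
  -- `G(s)` is symmetric positive definite, hence invertible
  have hGsym : ∀ x y, G x y = G y x := fun x y => by
    rw [hG, hG, pkg_G_symm hAdm hlap he hFI hω hl hβ hT s]
  have hGG : G⁻¹ * G = 1 := Matrix.nonsing_inv_mul G
    ((Matrix.isUnit_iff_isUnit_det G).1 (posDef_of_symm_of_pos G hGsym hGp).isUnit)
  -- admissibility of the observables
  have hjb : ∀ c, Adm ((pinnedChain ω₂ lam β γ).bondCurrent N c) :=
    fun c => adm_bondCurrent Adm hAdm hω hl hβ hT c
  have hex : ∀ u, Adm (e u) := fun u => adm_e Adm hAdm e he hω hl hβ hT u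
  have hLf : ∀ x, Adm ((pinnedChain ω₂ lam β γ).generator N T T (e x)) :=
    adm_generator_e hAdm hGSE hω hl hβ hT (e := e)
  have hp : ∀ y, Adm (fun z : PhaseSpace N => z.2 y ^ 2) := fun y => adm_psq Adm hAdm hω hl hβ hT y
  -- second-slot decomposition of `J` against any admissible `f`
  have hdec : ∀ f, Adm f →
      lap s f (fun z => ∑ i : Fin N, (pinnedChain ω₂ lam β γ).bondCurrent N i z) =
      (∑ x : Fin N, ((x.val : ℝ) - a) * lap s f ((pinnedChain ω₂ lam β γ).generator N T T (e x))) +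
        (-(a * (pinnedChain ω₂ lam β γ).γ)) * lap s f (fun w => w.2 (⟨0, by omega⟩ : Fin N) ^ 2) +
        ((((N : ℝ) - 1) - a) * (pinnedChain ω₂ lam β γ).γ) *
          lap s f (fun w => w.2 (⟨N - 1, by omega⟩ : Fin N) ^ 2) :=
    fun f hf => lapR_lincomb hAdm hcorr hlap hFI hω hl hβ hγ hT (fun x : Fin N => (x.val : ℝ) - a)
      _ _ _ (fun x => (pinnedChain ω₂ lam β γ).generator N T T (e x)) _ _ _
      (totalCurrent_pointwise hGSE hN a) hLf (hp _) (hp _) hf hs.le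
  rw [schur_lincomb_right (lap s) schur e G hschur (fun x : Fin N => (x.val : ℝ) - a)
    (-(a * (pinnedChain ω₂ lam β γ).γ)) ((((N : ℝ) - 1) - a) * (pinnedChain ω₂ lam β γ).γ)
    ((pinnedChain ω₂ lam β γ).bondCurrent N b)
    (fun z => ∑ i : Fin N, (pinnedChain ω₂ lam β γ).bondCurrent N i z)
    (fun w => w.2 (⟨0, by omega⟩ : Fin N) ^ 2) (fun w => w.2 (⟨N - 1, by omega⟩ : Fin N) ^ 2)
    (fun x => (pinnedChain ω₂ lam β γ).generator N T T (e x)) (hdec _ (hjb b)) (fun u => hdec _ (hex u))]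
  simp only [schur_j_generator hAdm hcov he hFI hPS1 hω hl hβ hT hs G hG schur hschur hGG]
  have hreg : (∑ x : Fin N, ((x.val : ℝ) - a) * ∑ u, ∑ v,
      lap s ((pinnedChain ω₂ lam β γ).bondCurrent N b) (e u) * G⁻¹ u v * cov (e v) (e x)) =
      ∑ u, ∑ v, ∑ x : Fin N, lap s ((pinnedChain ω₂ lam β γ).bondCurrent N b) (e u) * G⁻¹ u v *
        cov (e v) (e x) * ((x.val : ℝ) - a) := by
    simp only [Finset.mul_sum]
    rw [Finset.sum_comm]
    refine Finset.sum_congr rfl fun u _ => ?_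
    rw [Finset.sum_comm]
    refine Finset.sum_congr rfl fun v _ => Finset.sum_congr rfl fun x _ => ?_
    ring
  rw [hreg]
  ring

end Canonical

end OrthogonalOhmLine.RegressionIdentity

open OrthogonalOhmLine.RegressionIdentity in
/-- **Stub R1** (`RegressionIdentity`, fixed `N`, every `s > 0`, free origin `a`; line `Sketch` of the
crux `OrthogonalOhm`): `schur_s(j_b, J) = reg_s(b; a) − a·γ·schur_s(j_b, p_0²) + (N−1−a)·γ·schur_s(j_b, p²_{N−1})`
with `reg_s(b;a) = Σ_{x,y,z} lap_s(j_b,e_x) (G(s)⁻¹)_{xy} cov(e_y,e_z) (z − a)`, from the route item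
`FeshbachIdentities` (Kolmogorov identity in the second slot extended by linearity, `G(s)` invertible),
the coboundary `J = Σ_x (x − a) L e_x − aγ p_0² + (N−1−a)γ p²_{N−1} + const` (`GeneratorSiteEnergy`
summed against `x − a`) and parity (`ParityStatics`: `cov(j_b, e_x) = 0`). -/
theorem stub_regressionIdentity : Summit.AtomisticToContinuum.FouriersLaw.Theses.HonestZwanzig.FeshbachIdentities →
    ∀ ω₂ lam β γ : ℝ, 0 < ω₂ → 0 < lam → 0 < β → 0 < γ → ∀ T : ℝ, 0 < T → ∀ N : ℕ, ∀ hN : 2 ≤ N, let P := Literature.MathematicalPhysics.KineticTheory.HeatConduction.pinnedChain ω₂ lam β γ; let X := Literature.MathematicalPhysics.KineticTheory.HeatConduction.PhaseSpace N; let μ : MeasureTheory.Measure X := P.gibbsMeasure N T; let corr : (X → ℝ) → (X → ℝ) → ℝ → ℝ := fun f g t => (∫ z, f z * (∫ y, g y ∂(P.transitionKernel N T T t.toNNReal z)) ∂μ) - (∫ z, f z ∂μ) * (∫ z, g z ∂μ); let lap : ℝ → (X → ℝ) → (X → ℝ) → ℝ := fun s f g => ∫ t in Set.Ioi (0 : ℝ),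 Real.exp (-(s * t)) * corr f g t; let e : Fin N → X → ℝ := fun x z => z.2 x ^ 2 / 2 + P.U (z.1 x) + ∑ j : Fin N, ((if j.val = x.val + 1 then P.V (z.1 j - z.1 x) / 2 else 0) + (if x.val = j.val + 1 then P.V (z.1 x - z.1 j) / 2 else 0)); let G : ℝ → Matrix (Fin N) (Fin N) ℝ := fun s => Matrix.of fun x y => lap s (e x) (e y); let schur : ℝ → (X → ℝ) → (X → ℝ) → ℝ := fun s f g => lap s f g - ∑ x : Fin N, ∑ y : Fin N, lap s f (e x) * (G s)⁻¹ x y * lap s (e y) g; let J : X → ℝ := fun z => ∑ i : Fin N, P.bondCurrent N i z; let cov : (X → ℝ) → (X → ℝ) → ℝ := fun f g => (∫ z, f z * g z ∂μ) - (∫ z, f z ∂μ) * (∫ z, g z ∂μ); let reg : ℝ → Fin N → ℝ → ℝ := fun s b a => ∑ x : Fin N, ∑ y : Fin N, ∑ z : Fin N, lap s (P.bondCurrent N b) (e x) * (G s)⁻¹ x y * cov (e y) (e z) * ((z.val : ℝ) - a); ∀ s : ℝ, 0 < s → ∀ b : Fin N, ∀ a : ℝ,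
        schur s (P.bondCurrent N b) J =
          reg s b a - a * P.γ * schur s (P.bondCurrent N b) (fun w => w.2 ⟨0, by omega⟩ ^ 2) +
            (((N : ℝ) - 1) - a) * P.γ * schur s (P.bondCurrent N b) (fun w => w.2 ⟨N - 1, by omega⟩ ^ 2) := by
  intro hFI ω₂ lam β γ hω hl hβ hγ T hT N hN P X μ corr lap e G schur J cov reg s hs b a
  obtain ⟨-, hFI2, -, hGp⟩ := hFI ω₂ lam β γ hω hl hβ hγ T hT N hN
  exact regressionIdentity_fixed (ω₂ := ω₂) (lam := lam) (β := β) (γ := γ) (N := N) (T := T)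
    (corr := corr) (lap := lap) (cov := cov) (e := e)
    (fun f => Iff.rfl) (fun f g t => rfl) (fun s f g => rfl) (fun f g => rfl) (fun x z => rfl) hFI2
    (fun x z => generatorSiteEnergy_proof ω₂ lam β γ N hN T T x z)
    (fun x c => ((parityStatics_proof ω₂ lam β γ hω hl hβ hγ T hT N hN) x).1 c)
    hω hl.le hβ.le hγ.le hT hN hs (G s) (fun x y => rfl) (schur s) (fun f g => rfl) (hGp s hs) b a

end Summit.AtomisticToContinuum.FouriersLaw.Theorems.HonestZwanzig

end
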